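import Summits.QuantumFields.YangMills.Theorems.SwapVirialDeficitGnomonicJetFour
import Summits.QuantumFields.YangMills.Theorems.SwapVirialDeficitGnomonicJetWords
import HarnessLib

/-!
# W4 (order-4 jets), part K4: 4-JETS OF THE COUPLING, PLAQUETTE, WILSON AND SEAM TERMS along a moving quaternion history
# (free-hands support of ⟨stmt-QuantumFields-24197⟩ `SwapVirialDeficit.SwapGluedStiffness`)

Order-four twin of ✓`…GnomonicJetWords` (J3a), for LEAD g97's brick W4, on K1's package (✓`jet4_mul`, ✓`realJet4_re_term`, ✓`realJet4_sum`):
* ★ `realJet4_qTimeCoupling` — bounds `|Edge|·(2(a+b), 2(a+b)², 6(a+b)³, 18(a+b)⁴)`; ★ `jet4_qPlaq` (size `4a`); ★ `realJet4_qWilson`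
  (bounds `|Plaquette|·(8a, 32a², 384a³, 4608a⁴)`); ★ `jet4_qSeam` (size `M + M + M`).
Part K5 sums these over ✓`BlowUp.qDeficit`'s slices (`|d⁴/dt⁴ qDeficit| ≤ 609984·L⁴·M⁴`) and instantiates along the gnomonic blow-up (K3).

HONEST LABEL: calculus bookkeeping (no measure, no estimate on the ring's Gibbs state); nothing about ⟨24197⟩ (window-uniform, OPEN), (LW), (M), W3–W9 or any rung is
proved; ⟨24194⟩ ∕ ⟨24196⟩ ∕ ⟨24497⟩ OPEN; item of record ⟨24085⟩ SubOctaveBounded aside ∕ untouched; the Yang–Mills mass gap is NOT proved; no summit is proved by a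
line.  THEOREMS ONLY (0 `def`, 0 `sorry`), standard axioms, no local instances.  Seat ym-line-fcl-p3 g47 (cell ym-idea-1, free hands),
`--supports stmt-QuantumFields-24197`.  References: [cite: Luscher1983, §2] (the ring functional); [folklore] (Leibniz rule).
-/

set_option autoImplicit false

noncomputable section

open Quaternion
open scoped Quaternion BigOperators
open Literature.MathematicalPhysics.QuantumLattice
open Literature.MathematicalPhysics.QuantumFieldTheory hiding SU2
open Summit.QuantumFields.YangMills.Theorems.SwapVirialDeficit.BlowUp (qTimeCoupling qPlaq qWilson qGauge qTwist3 qSwap qSeam qDeficit)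

namespace Summit.QuantumFields.YangMills.Theorems.SwapVirialDeficit.Gnomonic

variable {L : ℕ} [NeZero L]

/-! ## §1 The time coupling, the plaquette word and the Wilson action -/

/-- ★ **`qTimeCoupling` carries a real 4-jet**: links with 4-jets of sizes `a` (first slot) and `b` (second slot) give
`|dᵏ/dtᵏ Σ_e 2 re(U_e V̄_e)| ≤ |Edge|·(2(a+b), 2(a+b)², 6(a+b)³, 18(a+b)⁴)`. [cite: Luscher1983, §2] -/
theorem realJet4_qTimeCoupling {U V : ℝ → Edge 3 L → ℍ} {a b : ℝ} (ha : 0 ≤ a) (hb : 0 ≤ b)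
    (hU : ∀ e, ∃ f₁ f₂ f₃ f₄ : ℝ → ℍ, (∀ t, HasDerivAt (fun t => U t e) (f₁ t) t) ∧ (∀ t, HasDerivAt f₁ (f₂ t) t) ∧ (∀ t, HasDerivAt f₂ (f₃ t) t) ∧
      (∀ t, HasDerivAt f₃ (f₄ t) t) ∧ ∀ t, ‖U t e‖ ≤ 1 ∧ ‖f₁ t‖ ≤ a ∧ ‖f₂ t‖ ≤ a ^ 2 ∧ ‖f₃ t‖ ≤ 3 * a ^ 3 ∧ ‖f₄ t‖ ≤ 9 * a ^ 4)
    (hV : ∀ e, ∃ f₁ f₂ f₃ f₄ : ℝ → ℍ, (∀ t, HasDerivAt (fun t => V t e) (f₁ t) t) ∧ (∀ t, HasDerivAt f₁ (f₂ t) t) ∧ (∀ t, HasDerivAt f₂ (f₃ t) t) ∧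
      (∀ t, HasDerivAt f₃ (f₄ t) t) ∧ ∀ t, ‖V t e‖ ≤ 1 ∧ ‖f₁ t‖ ≤ b ∧ ‖f₂ t‖ ≤ b ^ 2 ∧ ‖f₃ t‖ ≤ 3 * b ^ 3 ∧ ‖f₄ t‖ ≤ 9 * b ^ 4) :
    ∃ d₁ d₂ d₃ d₄ : ℝ → ℝ, (∀ t, HasDerivAt (fun t => qTimeCoupling (U t) (V t)) (d₁ t) t) ∧ (∀ t, HasDerivAt d₁ (d₂ t) t) ∧
      (∀ t, HasDerivAt d₂ (d₃ t) t) ∧ (∀ t, HasDerivAt d₃ (d₄ t) t) ∧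
      ∀ t, |d₁ t| ≤ Fintype.card (Edge 3 L) * (2 * (a + b)) ∧ |d₂ t| ≤ Fintype.card (Edge 3 L) * (2 * (a + b) ^ 2) ∧
        |d₃ t| ≤ Fintype.card (Edge 3 L) * (6 * (a + b) ^ 3) ∧ |d₄ t| ≤ Fintype.card (Edge 3 L) * (18 * (a + b) ^ 4) := by
  have hterm : ∀ e : Edge 3 L, ∃ d₁ d₂ d₃ d₄ : ℝ → ℝ, (∀ t, HasDerivAt (fun t => 2 * (U t e * star (V t e)).re) (d₁ t) t) ∧
      (∀ t, HasDerivAt d₁ (d₂ t) t) ∧ (∀ t, HasDerivAt d₂ (d₃ t) t) ∧ (∀ t, HasDerivAt d₃ (d₄ t) t) ∧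
      ∀ t, |d₁ t| ≤ 2 * (a + b) ∧ |d₂ t| ≤ 2 * (a + b) ^ 2 ∧ |d₃ t| ≤ 6 * (a + b) ^ 3 ∧ |d₄ t| ≤ 18 * (a + b) ^ 4 := by
    intro e
    have hw := jet4_mul ha hb (hU e) (jet4_star (hV e))
    have h := realJet4_mul_re 2 hw
    exact realJet4_mono (by norm_num) (by norm_num) (by norm_num; nlinarith [pow_nonneg (add_nonneg ha hb) 3])
      (by norm_num; nlinarith [pow_nonneg (add_nonneg ha hb) 4]) h
  have hs := realJet4_sum hterm
  simp only [Finset.sum_const, Finset.card_univ, nsmul_eq_mul] at hs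
  exact hs

omit [NeZero L] in
/-- ★ **The plaquette word carries a 4-jet of size `4a`** (links of size `a`; two conjugates). [folklore] -/
theorem jet4_qPlaq {U : ℝ → Edge 3 L → ℍ} {a : ℝ} (ha : 0 ≤ a)
    (hU : ∀ e, ∃ f₁ f₂ f₃ f₄ : ℝ → ℍ, (∀ t, HasDerivAt (fun t => U t e) (f₁ t) t) ∧ (∀ t, HasDerivAt f₁ (f₂ t) t) ∧ (∀ t, HasDerivAt f₂ (f₃ t) t) ∧
      (∀ t, HasDerivAt f₃ (f₄ t) t) ∧ ∀ t, ‖U t e‖ ≤ 1 ∧ ‖f₁ t‖ ≤ a ∧ ‖f₂ t‖ ≤ a ^ 2 ∧ ‖f₃ t‖ ≤ 3 * a ^ 3 ∧ ‖f₄ t‖ ≤ 9 * a ^ 4)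
    (x : Site 3 L) (i j : Fin 3) :
    ∃ f₁ f₂ f₃ f₄ : ℝ → ℍ, (∀ t, HasDerivAt (fun t => qPlaq (U t) x i j) (f₁ t) t) ∧ (∀ t, HasDerivAt f₁ (f₂ t) t) ∧ (∀ t, HasDerivAt f₂ (f₃ t) t) ∧
      (∀ t, HasDerivAt f₃ (f₄ t) t) ∧ ∀ t, ‖qPlaq (U t) x i j‖ ≤ 1 ∧ ‖f₁ t‖ ≤ (4 * a) ∧ ‖f₂ t‖ ≤ (4 * a) ^ 2 ∧ ‖f₃ t‖ ≤ 3 * (4 * a) ^ 3 ∧ ‖f₄ t‖ ≤ 9 * (4 * a) ^ 4 := by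
  have h2 := jet4_mul ha ha (hU (x, i)) (hU (x.shift i, j))
  have h3 := jet4_mul (add_nonneg ha ha) ha h2 (jet4_star (hU (x.shift j, i)))
  have h4 := jet4_mul (add_nonneg (add_nonneg ha ha) ha) ha h3 (jet4_star (hU (x, j)))
  have e : a + a + a + a = 4 * a := by ring
  rw [e] at h4
  simpa only [qPlaq] using h4

/-- ★ **`qWilson` carries a real 4-jet**: `|dᵏ/dtᵏ Σ_p (2 − 2 re(plaquette))| ≤ |Plaquette|·(8a, 32a², 384a³, 4608a⁴)`. [cite: Luscher1983, §2] -/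
theorem realJet4_qWilson {U : ℝ → Edge 3 L → ℍ} {a : ℝ} (ha : 0 ≤ a)
    (hU : ∀ e, ∃ f₁ f₂ f₃ f₄ : ℝ → ℍ, (∀ t, HasDerivAt (fun t => U t e) (f₁ t) t) ∧ (∀ t, HasDerivAt f₁ (f₂ t) t) ∧ (∀ t, HasDerivAt f₂ (f₃ t) t) ∧
      (∀ t, HasDerivAt f₃ (f₄ t) t) ∧ ∀ t, ‖U t e‖ ≤ 1 ∧ ‖f₁ t‖ ≤ a ∧ ‖f₂ t‖ ≤ a ^ 2 ∧ ‖f₃ t‖ ≤ 3 * a ^ 3 ∧ ‖f₄ t‖ ≤ 9 * a ^ 4) :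
    ∃ d₁ d₂ d₃ d₄ : ℝ → ℝ, (∀ t, HasDerivAt (fun t => qWilson (U t)) (d₁ t) t) ∧ (∀ t, HasDerivAt d₁ (d₂ t) t) ∧ (∀ t, HasDerivAt d₂ (d₃ t) t) ∧
      (∀ t, HasDerivAt d₃ (d₄ t) t) ∧
      ∀ t, |d₁ t| ≤ Fintype.card (Plaquette 3 L) * (8 * a) ∧ |d₂ t| ≤ Fintype.card (Plaquette 3 L) * (32 * a ^ 2) ∧
        |d₃ t| ≤ Fintype.card (Plaquette 3 L) * (384 * a ^ 3) ∧ |d₄ t| ≤ Fintype.card (Plaquette 3 L) * (4608 * a ^ 4) := by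
  have hterm : ∀ p : Plaquette 3 L, ∃ d₁ d₂ d₃ d₄ : ℝ → ℝ, (∀ t, HasDerivAt (fun t => 2 - 2 * (qPlaq (U t) p.1 p.2.1.1 p.2.1.2).re) (d₁ t) t) ∧
      (∀ t, HasDerivAt d₁ (d₂ t) t) ∧ (∀ t, HasDerivAt d₂ (d₃ t) t) ∧ (∀ t, HasDerivAt d₃ (d₄ t) t) ∧
      ∀ t, |d₁ t| ≤ 8 * a ∧ |d₂ t| ≤ 32 * a ^ 2 ∧ |d₃ t| ≤ 384 * a ^ 3 ∧ |d₄ t| ≤ 4608 * a ^ 4 := by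
    intro p
    have h := realJet4_re_term 2 2 (jet4_qPlaq ha hU p.1 p.2.1.1 p.2.1.2)
    refine realJet4_mono ?_ ?_ ?_ ?_ h
    · rw [abs_two]; linarith
    · rw [abs_two]; nlinarith
    · rw [abs_two]; nlinarith [pow_nonneg ha 3]
    · rw [abs_two]; nlinarith [pow_nonneg ha 4]
  have hs := realJet4_sum hterm
  simp only [Finset.sum_const, Finset.card_univ, nsmul_eq_mul] at hs
  simpa only [qWilson] using hs

/-! ## §2 The σ-glued seam -/

omit [NeZero L] in
/-- ★ **The σ-glued seam links carry 4-jets of size `M + M + M`** along a history whose links and sites carry 4-jets of size `M`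
(a word `g(x)·(±U₀(σe))·ḡ(x')`; ✓`qSeam`, ✓`qTwist3`, ✓`qSwap`). [cite: tHooft1979] -/
theorem jet4_qSeam (z : Fin 3 → Bool) {Q : ℝ → (Fin (2 * L - 1 + 1) → Edge 3 L → ℍ) × (Site 3 L → ℍ)} {M : ℝ} (hM : 0 ≤ M)
    (h1 : ∀ i e, ∃ f₁ f₂ f₃ f₄ : ℝ → ℍ, (∀ t, HasDerivAt (fun t => (Q t).1 i e) (f₁ t) t) ∧ (∀ t, HasDerivAt f₁ (f₂ t) t) ∧ (∀ t, HasDerivAt f₂ (f₃ t) t) ∧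
      (∀ t, HasDerivAt f₃ (f₄ t) t) ∧ ∀ t, ‖(Q t).1 i e‖ ≤ 1 ∧ ‖f₁ t‖ ≤ M ∧ ‖f₂ t‖ ≤ M ^ 2 ∧ ‖f₃ t‖ ≤ 3 * M ^ 3 ∧ ‖f₄ t‖ ≤ 9 * M ^ 4)
    (h2 : ∀ x, ∃ f₁ f₂ f₃ f₄ : ℝ → ℍ, (∀ t, HasDerivAt (fun t => (Q t).2 x) (f₁ t) t) ∧ (∀ t, HasDerivAt f₁ (f₂ t) t) ∧ (∀ t, HasDerivAt f₂ (f₃ t) t) ∧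
      (∀ t, HasDerivAt f₃ (f₄ t) t) ∧ ∀ t, ‖(Q t).2 x‖ ≤ 1 ∧ ‖f₁ t‖ ≤ M ∧ ‖f₂ t‖ ≤ M ^ 2 ∧ ‖f₃ t‖ ≤ 3 * M ^ 3 ∧ ‖f₄ t‖ ≤ 9 * M ^ 4) (e : Edge 3 L) :
    ∃ f₁ f₂ f₃ f₄ : ℝ → ℍ, (∀ t, HasDerivAt (fun t => qSeam z (Q t) e) (f₁ t) t) ∧ (∀ t, HasDerivAt f₁ (f₂ t) t) ∧ (∀ t, HasDerivAt f₂ (f₃ t) t) ∧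
      (∀ t, HasDerivAt f₃ (f₄ t) t) ∧ ∀ t, ‖qSeam z (Q t) e‖ ≤ 1 ∧ ‖f₁ t‖ ≤ (M + M + M) ∧ ‖f₂ t‖ ≤ (M + M + M) ^ 2 ∧ ‖f₃ t‖ ≤ 3 * (M + M + M) ^ 3 ∧ ‖f₄ t‖ ≤ 9 * (M + M + M) ^ 4 := by
  set e' : Edge 3 L := (sitePerm (L := L) (Equiv.swap (0 : Fin 3) 1).symm e.1, (Equiv.swap (0 : Fin 3) 1).symm e.2) with he'
  have hmid : ∃ f₁ f₂ f₃ f₄ : ℝ → ℍ, (∀ t, HasDerivAt (fun t => qTwist3 z (qSwap ((Q t).1 0)) e) (f₁ t) t) ∧ (∀ t, HasDerivAt f₁ (f₂ t) t) ∧ (∀ t, HasDerivAt f₂ (f₃ t) t) ∧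
      (∀ t, HasDerivAt f₃ (f₄ t) t) ∧ ∀ t, ‖qTwist3 z (qSwap ((Q t).1 0)) e‖ ≤ 1 ∧ ‖f₁ t‖ ≤ M ∧ ‖f₂ t‖ ≤ M ^ 2 ∧ ‖f₃ t‖ ≤ 3 * M ^ 3 ∧ ‖f₄ t‖ ≤ 9 * M ^ 4 := by
    by_cases hc : e.1 e.2 = 0 ∧ z e.2 = true
    · have ef : ∀ t, qTwist3 z (qSwap ((Q t).1 0)) e = -((Q t).1 0 e') := fun t => by
        simp only [qTwist3, qSwap, hc, and_self, if_true, he']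
      simp only [ef]
      exact jet4_neg (h1 0 e')
    · have ef : ∀ t, qTwist3 z (qSwap ((Q t).1 0)) e = (Q t).1 0 e' := fun t => by
        simp only [qTwist3, qSwap, hc, if_false, he']
      simp only [ef]
      exact h1 0 e'
  have hA := jet4_mul hM hM (h2 e.1) hmid
  have hB := jet4_mul (add_nonneg hM hM) hM hA (jet4_star (h2 (e.1.shift e.2)))
  simpa only [qSeam, qGauge] using hB

end Summit.QuantumFields.YangMills.Theorems.SwapVirialDeficit.Gnomonic

end
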